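import Summits.QuantumAdvantage.QuantumAdvantage.Theses.CubicForrelation
import Literature.Computability.QuantumComplexity.SignedCubicForrelation
import Literature.Computability.QuantumComplexity.ForrelationDerivativeTables
import Literature.Computability.QuantumComplexity.ForrelationDirectSum

/-!
# Sketch — crux-ideate stmt-QuantumAdvantage-13931 (ideator 1, round 1)

Crux `X := SignedCubicForrelationNotPrBPP` (route CubicForrelation).  First lemmas of the idea cards

* `isodual-first-moment`: `sliceSum`, `reindex` (PROVED: for EVERY map `M`, the Forrelation double sum is the
  sum of its `2ⁿ` "graph-of-`M`" slices — nothing is squared, so the sign survives), `sliceSum_not_left`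
  (PROVED: slices are odd in `a`), `SliceIsGauss` (Prop: under isoduality `deg(a ⊕ b∘M) ≤ 2`, `M` linear,
  every slice is a signed QUADRATIC Walsh–Gauss sum), `FlatExactSlicesAgree` (Prop, elementary: on an exact
  pair with flat slices EVERY slice carries the sign), the diagonal sub-promise `diagonalSigned` and the two
  glue directions `X_of_diagonal_hard` (PROVED) / `DiagonalSignedInPrBPP` (the dequantisation target).
* `sign-monodromy-islands`: `NoFlip` (Prop: the sign cannot change along an in-promise one-sided move of
  relative weight `< 9/25`), `oneSided_exact_step` (Prop: exact formula for a one-sided move off an exact pair).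
-/

noncomputable section

set_option linter.dupNamespace false

namespace Summit.QuantumAdvantage.QuantumAdvantage.Cruxes.SignedCubicForrelationNotPrBPP.Ideator1

open Finset
open Literature.Computability.QuantumComplexity Literature.Computability.Complexity
open Literature.Computability.QuantumComplexity.BuzetChailloux (bxor bxorPerm bxorPerm_apply hw)
open Summit.QuantumAdvantage.QuantumAdvantage.Theses.CubicForrelation

variable {n : ℕ}

/-! ### Card `isodual-first-moment` -/

/-- The `h`-th **graph-of-`M` slice** of the Forrelation double sum:
`sliceSum a b M h = ∑_x (-1)^{a(x)} (-1)^{x·(Mx ⊕ h)} (-1)^{b(Mx ⊕ h)}` (`= 2ⁿ · g_M(h)` of the card). -/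
def sliceSum (a b : (Fin n → Bool) → Bool) (M : (Fin n → Bool) → (Fin n → Bool)) (h : Fin n → Bool) : ℝ :=
  ∑ x, signOf (a x) * twist x (bxor (M x) h) * signOf (b (bxor (M x) h))

/-- **Re-indexing identity (first lemma, proved).** For EVERY map `M : 𝔽₂ⁿ → 𝔽₂ⁿ` (no linearity, no
invertibility needed) `√(2^{3n}) · Φ(a,b) = ∑_h sliceSum a b M h`: substitute `y = Mx ⊕ h`. -/
theorem reindex (a b : (Fin n → Bool) → Bool) (M : (Fin n → Bool) → (Fin n → Bool)) :
    Real.sqrt (2 ^ (3 * n)) * forrelation a b = ∑ h, sliceSum a b M h := by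
  unfold forrelation sliceSum
  have hpos : Real.sqrt (2 ^ (3 * n)) ≠ 0 := by positivity
  rw [← mul_assoc, mul_inv_cancel₀ hpos, one_mul]
  conv_rhs => rw [Finset.sum_comm]
  refine Finset.sum_congr rfl fun x _ => ?_
  rw [← Equiv.sum_comp (bxorPerm (M x)) (fun y => signOf (a x) * twist x y * signOf (b y))]
  simp only [bxorPerm_apply]

/-- Slices are ODD in the first function (so nothing here is blind to `a ↦ ¬a`, unlike the derivative
tables of the `Φ²` lever, `DerivativeWalsh.dwt_signOf_not`). -/
theorem sliceSum_not_left (a b : (Fin n → Bool) → Bool) (M : (Fin n → Bool) → (Fin n → Bool))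
    (h : Fin n → Bool) : sliceSum (fun x => !a x) b M h = -sliceSum a b M h := by
  unfold sliceSum
  rw [← Finset.sum_neg_distrib]
  refine Finset.sum_congr rfl fun x _ => ?_
  rw [DerivativeWalsh.signOf_not]
  ring

/-- `M` is 𝔽₂-linear on bit vectors. -/
def IsLinearMap (M : (Fin n → Bool) → (Fin n → Bool)) : Prop :=
  ∀ x y, M (bxor x y) = bxor (M x) (M y)

/-- **Isoduality ⇒ Gauss slices (second lemma of the line, stated).** If `b` is cubic, `M` is linear and the
cubic parts agree through `M` (`deg(a ⊕ b∘M) ≤ 2`, i.e. `T_a = T_b ∘ M`), then every slice is a signed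
quadratic Walsh–Gauss sum `∑_x (-1)^{q_h(x)}`, `deg q_h ≤ 2` — hence classically computable EXACTLY with its
sign in `O(n³)` (Dickson; tree: `BravyiGosset.GData.gaussEval`, `QuadraticWalshGaussSum`).
Proof sketch: `q_h(x) = a(x) ⊕ x·(Mx ⊕ h) ⊕ b(Mx ⊕ h)`; `b(Mx ⊕ h) ⊕ b(Mx) = (D_h b)(Mx)` has degree ≤ 2
(derivative of a cubic, composed with a linear map); `x·Mx` is quadratic, `x·h` linear. -/
def SliceIsGauss : Prop :=
  ∀ (n : ℕ) (a b : (Fin n → Bool) → Bool) (M : (Fin n → Bool) → (Fin n → Bool)),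
    IsLinearMap M → IsDegLeFun 3 b → IsDegLeFun 2 (fun x => xor (a x) (b (M x))) →
    ∀ h, ∃ q : (Fin n → Bool) → Bool, IsDegLeFun 2 q ∧ sliceSum a b M h = ∑ x, signOf (q x)

/-- `√(2^{3n}) = 2ⁿ·√(2ⁿ)` (copy of `ForrelationSignTransport.sqrt_two_pow_three_mul`, restated to keep this
sketch's dependencies visible). -/
theorem ForrelationSignTransport_sqrt (n : ℕ) :
    Real.sqrt ((2 : ℝ) ^ (3 * n)) = (2 : ℝ) ^ n * Real.sqrt ((2 : ℝ) ^ n) := by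
  rw [show (2 : ℝ) ^ (3 * n) = ((2 : ℝ) ^ n) ^ 2 * (2 : ℝ) ^ n by ring,
    Real.sqrt_mul (by positivity), Real.sqrt_sq (by positivity)]

/-- **Flat exact slices all carry the sign (stated; elementary).** If `Φ(a,b) = ±1` and every slice is
`0` or `± 2^{n/2}` (all slice quadratics of full rank), then — because `2ⁿ` slices of modulus `≤ 2^{n/2}`
must sum to `± 2^{3n/2}` — EVERY slice equals `Φ · 2^{n/2}`: one deterministic Gauss sum decides the sign. -/
def FlatExactSlicesAgree : Prop :=
  ∀ (n : ℕ) (a b : (Fin n → Bool) → Bool) (M : (Fin n → Bool) → (Fin n → Bool)),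
    forrelation a b ^ 2 = 1 →
    (∀ h, sliceSum a b M h = 0 ∨ |sliceSum a b M h| = Real.sqrt (2 ^ n)) →
    ∀ h, sliceSum a b M h = forrelation a b * Real.sqrt (2 ^ n)

/-- `FlatExactSlicesAgree` holds (proved): the slack `R - Φ·s_h ≥ 0` sums to `0`. -/
theorem flatExactSlicesAgree : FlatExactSlicesAgree := by
  intro n a b M hΦ hflat h
  set R := Real.sqrt ((2 : ℝ) ^ n) with hR
  have hRpos : 0 < R := by rw [hR]; positivity
  have hΦ' : forrelation a b = 1 ∨ forrelation a b = -1 := by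
    have hm : (forrelation a b - 1) * (forrelation a b + 1) = 0 := by ring_nf; linarith [hΦ]
    rcases mul_eq_zero.1 hm with h1 | h1
    · exact Or.inl (by linarith)
    · exact Or.inr (by linarith)
  -- each slice is bounded by R in modulus
  have hbound : ∀ h', |sliceSum a b M h'| ≤ R := by
    intro h'
    rcases hflat h' with h0 | h1
    · rw [h0, abs_zero]; exact hRpos.le
    · exact h1.le
  -- the total
  have htot : ∑ h', sliceSum a b M h' = forrelation a b * ((2 : ℝ) ^ n * R) := by
    rw [← reindex a b M, ForrelationSignTransport_sqrt n]
    ring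
  -- slack terms
  have hslack_nonneg : ∀ h', 0 ≤ R - forrelation a b * sliceSum a b M h' := by
    intro h'
    have hb := hbound h'
    rcases hΦ' with e | e <;> rw [e] <;>
      [linarith [le_abs_self (sliceSum a b M h')]; linarith [neg_abs_le (sliceSum a b M h')]]
  have hcard : (Finset.univ : Finset (Fin n → Bool)).card = 2 ^ n := by
    simp [Fintype.card_bool, Fintype.card_fin]
  have hslack_sum : ∑ h', (R - forrelation a b * sliceSum a b M h') = 0 := by
    rw [Finset.sum_sub_distrib, Finset.sum_const, hcard, ← Finset.mul_sum, htot]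
    have : forrelation a b * forrelation a b = 1 := by nlinarith [hΦ]
    have e : forrelation a b * (forrelation a b * ((2 : ℝ) ^ n * R)) = (2 : ℝ) ^ n * R := by
      rw [← mul_assoc, this, one_mul]
    rw [e]
    simp only [nsmul_eq_mul]
    push_cast
    ring
  have hz := (Finset.sum_eq_zero_iff_of_nonneg fun h' _ => hslack_nonneg h').1 hslack_sum h (Finset.mem_univ _)
  have e1 : forrelation a b * sliceSum a b M h = R := by linarith
  rcases hΦ' with e | e
  · rw [e] at e1 ⊢; linarith
  · rw [e] at e1 ⊢; linarith

/-- The general sampling bound behind the estimator (stated): with `h` uniform, `Y := 2^{-n/2} sliceSum … h`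
has mean `Φ(a,b)` (by `reindex`) and second moment `V := 2^{-2n} ∑_h (sliceSum … h)²`; on the promise
`|Φ| ≥ 3/5`, `⌈100·V⌉` samples give the sign with probability `≥ 2/3` (Chebyshev). Here only the algebraic
identity `E[Y²] = V` is recorded. -/
def SecondMoment : Prop :=
  ∀ (n : ℕ) (a b : (Fin n → Bool) → Bool) (M : (Fin n → Bool) → (Fin n → Bool)),
    (2 : ℝ) ^ n * ∑ h, ((Real.sqrt (2 ^ n))⁻¹ * sliceSum a b M h) ^ 2 = ∑ h, sliceSum a b M h ^ 2

/-- The **diagonal sub-promise** (`M = id` is free): instances whose two circuits compute functions with the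
SAME cubic part, `deg(a ⊕ b) ≤ 2` — this contains the (anti-)self-dual slice `a = b` of the r3 card
`selfdual-collapse`. -/
def IsDiagonal (I : KForrelationInstance) : Prop :=
  ∀ hk : I.k = 2, IsDegLeFun 2 fun x =>
    xor ((I.C (Fin.cast hk.symm 0)).eval x) ((I.C (Fin.cast hk.symm 1)).eval x)

/-- Signed cubic 2-fold Forrelation restricted to the diagonal sub-promise. -/
def diagonalSigned : PromiseProblem :=
  ⟨KForrelationInstance.encode ''
      {I | (I.IsYes ∧ I.k = 2 ∧ Even I.n ∧ ∀ i, IsDegLeFun 3 (I.C i).eval) ∧ IsDiagonal I},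
   KForrelationInstance.encode ''
      {I | ((I.IsOverB2 ∧ I.value ≤ -(3 / 5 : ℝ)) ∧ I.k = 2 ∧ Even I.n ∧ ∀ i, IsDegLeFun 3 (I.C i).eval) ∧
        IsDiagonal I}⟩

/-- Glue, X-direction (PROVED): hardness of the diagonal sub-promise would already give the crux
(`PromiseBPP'` is antitone in the promise). The card argues this sub-promise is where hardness is LEAST
likely: every slice is a Gauss sum for free. -/
theorem X_of_diagonal_hard (h : diagonalSigned ∉ PromiseBPP') : SignedCubicForrelationNotPrBPP := by
  rintro ⟨L', hL', p, hyes, hno⟩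
  refine h ⟨L', hL', p, ?_, ?_⟩
  · rintro x ⟨I, ⟨hI, -⟩, rfl⟩
    exact hyes _ ⟨I, hI, rfl⟩
  · rintro x ⟨I, ⟨hI, -⟩, rfl⟩
    exact hno _ ⟨I, hI, rfl⟩

/-- The ¬X-direction TARGET suggested by the lever (conjectural: needs the variance `V` to be `poly(n)` on
the promise, or a structural fallback where it is not — see the card's corank dichotomy): the diagonal
sub-promise is classically decidable. Its failure would require diagonal promise instances with a heavy
tail of polar coranks, the only place the first-moment estimator is blind. -/
def DiagonalSignedInPrBPP : Prop := diagonalSigned ∈ PromiseBPP'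

/-! ### Card `sign-monodromy-islands` -/

/-- **No-flip lemma (stated; Cauchy–Schwarz + Parseval).** `|Φ(a,b) - Φ(a,b')| ≤ 2·√(d(b,b')/2ⁿ)`; hence if
both `(a,b)` and `(a,b')` satisfy `|Φ| ≥ 3/5` and `b, b'` differ on fewer than `(9/25)·2ⁿ` points, the two
signs agree: the sign is locally constant on the certified promise region (one-sided moves; by
`forrelation` symmetry the same for moves of `a`). -/
def NoFlip : Prop :=
  ∀ (n : ℕ) (a b b' : (Fin n → Bool) → Bool),
    |forrelation a b - forrelation a b'| ≤
      2 * Real.sqrt (((univ.filter fun y => b y ≠ b' y).card : ℝ) / 2 ^ n)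

/-- **One-sided step off an exact pair (stated; from `W_b = Φ·2^{n/2}·(-1)^a` pointwise, tree
`two_pow_mul_W_eq`):** if `Φ(a,b) = ε ∈ {±1}` then `Φ(a ⊕ e, b) = ε · (1 - 2·wt(e)/2ⁿ)` for every `e`; so an
in-promise one-sided move costs exactly `2·wt(e)/2ⁿ ≤ 2/5`, i.e. `wt(e) ≤ 2ⁿ/5 < 2·d_min(RM(3,n))` — the
Kasami–Tokura regime (flats `x₁x₂x₃`, `x₁(x₂x₃ ⊕ x₄x₅)`). This is the `g' = a ⊕ e` case of the r7 disprover's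
cross identity `forrelation_mul_cross_eq`. -/
def OneSidedExactStep : Prop :=
  ∀ (n : ℕ) (a b e : (Fin n → Bool) → Bool), forrelation a b ^ 2 = 1 →
    forrelation (fun x => xor (a x) (e x)) b =
      forrelation a b * (1 - 2 * ((univ.filter fun x => e x = true).card : ℝ) / 2 ^ n)

end Summit.QuantumAdvantage.QuantumAdvantage.Cruxes.SignedCubicForrelationNotPrBPP.Ideator1
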